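import Mathlib

/-!
# Stub `stub_layerCake` — the layer-cake (Tonelli) identity for the Stieltjes measure of a monotone function

For a monotone `G : ℝ → ℝ` vanishing on `(-∞, 0]` and a friction `γ > 0`,

`∫ (γ² + s²)⁻¹ dμ_G(s) = ∫_(0,∞) G(t) · 2t/(γ² + t²)² dt`,

both sides being `lintegral`s of `ENNReal.ofReal`, so that no finiteness of `G` or `μ_G` is needed. Here `μ_G` is
Mathlib's Lebesgue–Stieltjes measure of the right-continuous modification `rightLim G`
(`Monotone.stieltjesFunction`).

Proof: `μ_G` is carried by `[0, ∞)` (the Stieltjes function vanishes on `(-∞, 0)`); for `s ≥ 0` the kernel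
identity `(γ² + s²)⁻¹ = ∫_{t ≥ s} 2t/(γ² + t²)² dt` holds (primitive `-(γ² + x²)⁻¹ → 0` at `+∞`); Tonelli
(`MeasureTheory.lintegral_lintegral_swap`) on the measurable integrand `(s, t) ↦ 1{s ≤ t} · ofReal (2t/(γ² + t²)²)`;
the `t`-sections are `μ_G (Iic t) = ofReal (rightLim G t)` (`StieltjesFunction.measure_Iic`), and
`rightLim G t = G t` off the countable discontinuity set of `G` (`Monotone.countable_not_continuousAt`), i.e.
Lebesgue-almost everywhere; finally the kernel is nonpositive on `(-∞, 0]`, which restricts the outer integral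
to `(0, ∞)`.
-/

namespace Summit.AtomisticToContinuum.FouriersLaw.Theorems.ContactMeasureLimit

open MeasureTheory Filter Set Topology Function

open scoped ENNReal

/-! ## The kernel integral `∫_{t > a} 2t/(γ²+t²)² dt = (γ²+a²)⁻¹` -/

/-- `-(γ² + x²)⁻¹` is a primitive of the contact kernel `2x/(γ² + x²)²` (for `γ > 0`). -/
theorem layerCake_hasDerivAt_negInv {γ : ℝ} (hγ : 0 < γ) (s : ℝ) :
    HasDerivAt (fun x : ℝ => -(γ ^ 2 + x ^ 2)⁻¹) (2 * s / (γ ^ 2 + s ^ 2) ^ 2) s := by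
  have hpos : 0 < γ ^ 2 + s ^ 2 := by positivity
  have h1 : HasDerivAt (fun x : ℝ => γ ^ 2 + x ^ 2) (2 * s) s := by
    simpa using ((hasDerivAt_pow 2 s).const_add (γ ^ 2))
  have h2 := (h1.inv hpos.ne').neg
  refine h2.congr_deriv ?_
  rw [neg_div, neg_neg]

/-- `-(γ² + x²)⁻¹ → 0` as `x → +∞`. -/
theorem layerCake_tendsto_negInv (γ : ℝ) :
    Tendsto (fun x : ℝ => -(γ ^ 2 + x ^ 2)⁻¹) atTop (𝓝 0) := by
  have h : Tendsto (fun x : ℝ => γ ^ 2 + x ^ 2) atTop atTop :=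
    tendsto_atTop_add_const_left _ _ (tendsto_pow_atTop two_ne_zero)
  simpa using (tendsto_inv_atTop_zero.comp h).neg

/-- `x ↦ -(γ² + x²)⁻¹` is continuous for `γ > 0`. -/
theorem layerCake_continuous_negInv {γ : ℝ} (hγ : 0 < γ) :
    Continuous (fun x : ℝ => -(γ ^ 2 + x ^ 2)⁻¹) := by
  refine Continuous.neg (Continuous.inv₀ (by fun_prop) (fun x => ?_))
  positivity

/-- The kernel integral (Bochner form): for `γ > 0` and `a ≥ 0`, the contact kernel `2t/(γ² + t²)²` is integrable
on `(a, ∞)` and `∫_{(a,∞)} 2t/(γ² + t²)² dt = (γ² + a²)⁻¹`. -/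
theorem layerCake_integral_Ioi_kernel {γ : ℝ} (hγ : 0 < γ) {a : ℝ} (ha : 0 ≤ a) :
    IntegrableOn (fun t : ℝ => 2 * t / (γ ^ 2 + t ^ 2) ^ 2) (Ioi a) ∧
      ∫ t in Ioi a, 2 * t / (γ ^ 2 + t ^ 2) ^ 2 = (γ ^ 2 + a ^ 2)⁻¹ := by
  have hcont : ContinuousWithinAt (fun x : ℝ => -(γ ^ 2 + x ^ 2)⁻¹) (Ici a) a :=
    (layerCake_continuous_negInv hγ).continuousWithinAt
  have hderiv : ∀ x ∈ Ioi a,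
      HasDerivAt (fun x : ℝ => -(γ ^ 2 + x ^ 2)⁻¹) (2 * x / (γ ^ 2 + x ^ 2) ^ 2) x :=
    fun x _ => layerCake_hasDerivAt_negInv hγ x
  have hnn : ∀ x ∈ Ioi a, 0 ≤ 2 * x / (γ ^ 2 + x ^ 2) ^ 2 := fun x hx => by
    have hx0 : 0 ≤ x := ha.trans (le_of_lt hx)
    positivity
  have hint : IntegrableOn (fun t : ℝ => 2 * t / (γ ^ 2 + t ^ 2) ^ 2) (Ioi a) :=
    integrableOn_Ioi_deriv_of_nonneg hcont hderiv hnn (layerCake_tendsto_negInv γ)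
  refine ⟨hint, ?_⟩
  rw [integral_Ioi_of_hasDerivAt_of_tendsto hcont hderiv hint (layerCake_tendsto_negInv γ)]
  ring

/-- The kernel integral (`lintegral` form): for `γ > 0` and `s ≥ 0`,
`∫⁻_{[s,∞)} ofReal (2t/(γ² + t²)²) dt = ofReal ((γ² + s²)⁻¹)`. -/
theorem layerCake_lintegral_Ici_kernel {γ : ℝ} (hγ : 0 < γ) {s : ℝ} (hs : 0 ≤ s) :
    ∫⁻ t in Ici s, ENNReal.ofReal (2 * t / (γ ^ 2 + t ^ 2) ^ 2) =
      ENNReal.ofReal ((γ ^ 2 + s ^ 2)⁻¹) := by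
  obtain ⟨hint, hval⟩ := layerCake_integral_Ioi_kernel hγ hs
  have hnn : 0 ≤ᵐ[volume.restrict (Ioi s)] fun t : ℝ => 2 * t / (γ ^ 2 + t ^ 2) ^ 2 := by
    rw [EventuallyLE, ae_restrict_iff' measurableSet_Ioi]
    refine ae_of_all _ (fun t ht => ?_)
    have ht0 : 0 ≤ t := hs.trans (le_of_lt ht)
    simp only [Pi.zero_apply]
    positivity
  rw [setLIntegral_congr (Ioi_ae_eq_Ici (μ := (volume : Measure ℝ)) (a := s)).symm, ← hval,
    ofReal_integral_eq_lintegral_ofReal hint hnn]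

/-! ## Stieltjes-measure facts for a monotone `G` vanishing on `(-∞, 0]` -/

/-- The Stieltjes function (`= rightLim G`) of a monotone `G` vanishing on `(-∞, 0]` vanishes on `(-∞, 0)`. -/
theorem layerCake_stieltjes_eq_zero_of_neg {G : ℝ → ℝ} (hG : Monotone G)
    (hG0 : ∀ s : ℝ, s ≤ 0 → G s = 0) {y : ℝ} (hy : y < 0) : hG.stieltjesFunction y = 0 := by
  rw [hG.stieltjesFunction_eq]
  refine rightLim_eq_of_tendsto ?_
  refine (tendsto_const_nhds (x := (0 : ℝ))).congr' ?_
  filter_upwards [Ioo_mem_nhdsGT hy] with z hz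
  exact (hG0 z hz.2.le).symm

/-- The Stieltjes function of a monotone `G` vanishing on `(-∞, 0]` tends to `0` at `-∞`. -/
theorem layerCake_tendsto_stieltjes_atBot {G : ℝ → ℝ} (hG : Monotone G)
    (hG0 : ∀ s : ℝ, s ≤ 0 → G s = 0) : Tendsto (hG.stieltjesFunction) atBot (𝓝 0) := by
  refine (tendsto_const_nhds (x := (0 : ℝ))).congr' ?_
  filter_upwards [Iio_mem_atBot (0 : ℝ)] with z hz
  exact (layerCake_stieltjes_eq_zero_of_neg hG hG0 hz).symm

/-- The left limit at `0` of the Stieltjes function of a monotone `G` vanishing on `(-∞, 0]` is `0`. -/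
theorem layerCake_leftLim_stieltjes_zero {G : ℝ → ℝ} (hG : Monotone G)
    (hG0 : ∀ s : ℝ, s ≤ 0 → G s = 0) : leftLim (hG.stieltjesFunction) 0 = 0 := by
  refine leftLim_eq_of_tendsto ?_
  refine (tendsto_const_nhds (x := (0 : ℝ))).congr' ?_
  filter_upwards [self_mem_nhdsWithin] with z hz
  exact (layerCake_stieltjes_eq_zero_of_neg hG hG0 hz).symm

/-- The `t`-sections: `μ_G (Iic t) = ofReal (rightLim G t)`. -/
theorem layerCake_measure_Iic {G : ℝ → ℝ} (hG : Monotone G) (hG0 : ∀ s : ℝ, s ≤ 0 → G s = 0)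
    (t : ℝ) : hG.stieltjesFunction.measure (Iic t) = ENNReal.ofReal (rightLim G t) := by
  rw [StieltjesFunction.measure_Iic _ (layerCake_tendsto_stieltjes_atBot hG hG0), sub_zero,
    hG.stieltjesFunction_eq]

/-- `μ_G` is carried by `[0, ∞)`: `μ_G`-almost every point is nonnegative. -/
theorem layerCake_ae_nonneg {G : ℝ → ℝ} (hG : Monotone G) (hG0 : ∀ s : ℝ, s ≤ 0 → G s = 0) :
    ∀ᵐ s ∂(hG.stieltjesFunction.measure), 0 ≤ s := by
  rw [ae_iff]
  have hset : {s : ℝ | ¬0 ≤ s} = Iio 0 := by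
    ext s
    simp
  rw [hset, StieltjesFunction.measure_Iio _ (layerCake_tendsto_stieltjes_atBot hG hG0),
    layerCake_leftLim_stieltjes_zero hG hG0]
  simp

/-- For a monotone `G`, `rightLim G t = G t` for Lebesgue-almost every `t` (the discontinuity set is countable). -/
theorem layerCake_rightLim_ae_eq {G : ℝ → ℝ} (hG : Monotone G) :
    ∀ᵐ t ∂(volume : Measure ℝ), rightLim G t = G t := by
  have hS : (volume : Measure ℝ) {t : ℝ | ¬ContinuousAt G t} = 0 :=
    hG.countable_not_continuousAt.measure_zero _
  have hae : ∀ᵐ t ∂(volume : Measure ℝ), ContinuousAt G t := by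
    rw [ae_iff]
    exact hS
  filter_upwards [hae] with t ht
  exact ht.continuousWithinAt.rightLim_eq

/-- The Tonelli integrand `(s, t) ↦ 1{s ≤ t} · ofReal (2t/(γ² + t²)²)` is measurable on `ℝ × ℝ`. -/
theorem layerCake_measurable_integrand (γ : ℝ) :
    Measurable (fun p : ℝ × ℝ =>
      ({q : ℝ × ℝ | q.1 ≤ q.2}).indicator
        (fun q : ℝ × ℝ => ENNReal.ofReal (2 * q.2 / (γ ^ 2 + q.2 ^ 2) ^ 2)) p) := by
  refine Measurable.indicator ?_ (measurableSet_le measurable_fst measurable_snd)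
  fun_prop

/-! ## The identity -/

/-- **Layer cake for the contact kernel** (`lintegral` form, no finiteness needed): for a monotone `G : ℝ → ℝ`
vanishing on `(-∞, 0]` and `γ > 0`,
`∫⁻ ofReal ((γ² + s²)⁻¹) dμ_G(s) = ∫⁻_{(0,∞)} ofReal (G t · 2t/(γ² + t²)²) dt`,
`μ_G = hG.stieltjesFunction.measure` the Lebesgue–Stieltjes measure of `rightLim G`. Tonelli on
`(s, t) ↦ 1{s ≤ t} · ofReal (2t/(γ² + t²)²)` w.r.t. `μ_G ⊗ vol`: the `s`-sections are `ofReal ((γ² + s²)⁻¹)` for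
`s ≥ 0` (`μ_G`-a.e. `s`), the `t`-sections are `ofReal (2t/(γ² + t²)²) · μ_G (Iic t)` with
`μ_G (Iic t) = ofReal (rightLim G t) = ofReal (G t)` for Lebesgue-a.e. `t`. -/
theorem stub_layerCake :
    ∀ (G : ℝ → ℝ) (hG : Monotone G), (∀ s : ℝ, s ≤ 0 → G s = 0) → ∀ γ : ℝ, 0 < γ →
      ∫⁻ s, ENNReal.ofReal ((γ ^ 2 + s ^ 2)⁻¹) ∂(hG.stieltjesFunction.measure) =
        ∫⁻ t in Set.Ioi (0 : ℝ), ENNReal.ofReal (G t * (2 * t / (γ ^ 2 + t ^ 2) ^ 2)) := by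
  intro G hG hG0 γ hγ
  -- the Tonelli integrand and its two families of sections
  set Φ : ℝ → ℝ → ℝ≥0∞ := fun s t =>
    ({q : ℝ × ℝ | q.1 ≤ q.2}).indicator
      (fun q : ℝ × ℝ => ENNReal.ofReal (2 * q.2 / (γ ^ 2 + q.2 ^ 2) ^ 2)) (s, t) with hΦ
  have hΦ_s : ∀ s t : ℝ,
      Φ s t = (Ici s).indicator (fun u : ℝ => ENNReal.ofReal (2 * u / (γ ^ 2 + u ^ 2) ^ 2)) t := by
    intro s t
    simp only [hΦ, Set.indicator_apply, Set.mem_setOf_eq, Set.mem_Ici]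
  have hΦ_t : ∀ s t : ℝ,
      Φ s t = (Iic t).indicator (fun _ : ℝ => ENNReal.ofReal (2 * t / (γ ^ 2 + t ^ 2) ^ 2)) s := by
    intro s t
    simp only [hΦ, Set.indicator_apply, Set.mem_setOf_eq, Set.mem_Iic]
  have hmeas : AEMeasurable (uncurry Φ) ((hG.stieltjesFunction.measure).prod volume) :=
    (layerCake_measurable_integrand γ).aemeasurable
  -- `s`-sections, valid for `s ≥ 0`, i.e. `μ_G`-almost everywhere
  have h1 : ∀ s : ℝ, 0 ≤ s → ENNReal.ofReal ((γ ^ 2 + s ^ 2)⁻¹) = ∫⁻ t, Φ s t := by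
    intro s hs
    simp_rw [hΦ_s]
    rw [lintegral_indicator measurableSet_Ici, layerCake_lintegral_Ici_kernel hγ hs]
  have h2 : ∫⁻ s, ENNReal.ofReal ((γ ^ 2 + s ^ 2)⁻¹) ∂(hG.stieltjesFunction.measure) =
      ∫⁻ s, ∫⁻ t, Φ s t ∂volume ∂(hG.stieltjesFunction.measure) := by
    refine lintegral_congr_ae ?_
    filter_upwards [layerCake_ae_nonneg hG hG0] with s hs
    exact h1 s hs
  -- `t`-sections
  have h3 : ∀ t : ℝ, ∫⁻ s, Φ s t ∂(hG.stieltjesFunction.measure) =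
      ENNReal.ofReal (2 * t / (γ ^ 2 + t ^ 2) ^ 2) * ENNReal.ofReal (rightLim G t) := by
    intro t
    simp_rw [hΦ_t]
    rw [lintegral_indicator_const measurableSet_Iic, layerCake_measure_Iic hG hG0]
  rw [h2, lintegral_lintegral_swap hmeas]
  simp_rw [h3]
  rw [← lintegral_indicator measurableSet_Ioi]
  refine lintegral_congr_ae ?_
  filter_upwards [layerCake_rightLim_ae_eq hG] with t ht
  rw [ht]
  by_cases h0 : 0 < t
  · -- `0 ≤ G t` for `t > 0` (monotone, `G 0 = 0`)
    have hGt : 0 ≤ G t := by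
      have h := hG h0.le
      rwa [hG0 0 le_rfl] at h
    rw [Set.indicator_of_mem (show t ∈ Ioi (0 : ℝ) from h0), mul_comm, ← ENNReal.ofReal_mul hGt]
  · rw [Set.indicator_of_notMem (show t ∉ Ioi (0 : ℝ) from h0)]
    have hk : 2 * t / (γ ^ 2 + t ^ 2) ^ 2 ≤ 0 :=
      div_nonpos_of_nonpos_of_nonneg (by linarith [not_lt.mp h0]) (by positivity)
    rw [ENNReal.ofReal_of_nonpos hk, zero_mul]

end Summit.AtomisticToContinuum.FouriersLaw.Theorems.ContactMeasureLimit
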